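import Summits.CriticalPhenomena.PercolationContinuityZ3.Theorems.PercNearOneGluingNoHeavyLowerTailSahiCombTriWAndMaj3
import Summits.CriticalPhenomena.PercolationContinuityZ3.Theorems.PercNearOneGluingNoHeavyLowerTailSahiCombTriWAndQ311Profile

/-!
# AND with the block `Q(3,1,1) = maj₃(x₀, x₁, z₂z₃z₄)`, part 2: the block, generic fibre columns, sorted profiles and the five certificate words

Support file of the one-cut programme (crux `NoHeavyLowerTail`, stmt-CriticalPhenomena-4575; unit `prim-lf-1` gen 58, memo
`FROM-prim-lf-1-gen57-PERFECT4.md` §7).  Part 2 of the Q(3,1,1) certificate (part 1: `…AndQ311Profile`, the Profile Lemma; part 3: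
`…AndQ311`, the theorem).
`q311 = maj₃(x₀, x₁, z₂z₃z₄) ⊆ 2^{Fin 5}` (points `⊤`, `h = {0,1}`, `{0,1,i}`, `⊤ − i` (`i = 2,3,4`), `a = ⊤ − 1`, `b = ⊤ − 0`) is the
AND-substituted claw `Q(3,1,1)` — the first block with a generator complement of size three, the frontier of the substitution conjecture of
gens 49–51 (no symbol-cone certificate exists for it).  The certificate transcribed here was found by the complete support-mode
local-certificate LP of gen 57 and verified there in exact arithmetic.
* GENERIC fibre columns `bcol A y x = δ_A(x ⊔ y)` of a family `A ⊆ 2^{γ₁ ⊕ γ₂}` (any block type `γ₂`): monotone in `x` and in `y`, values in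
  `[-1,1]`, and the PAIR CONDITION `δ_A(x⊔y) + δ_A(x'⊔y') ≥ 0` whenever `x ∪ x' = ⊤`, `y ∪ y' = ⊤` (reusable for every block);
* the named columns `u, h, o_i, t_i, a, b` of `q311`, the sorted profiles of the `o`- and `t`-triples and of the pair `(a,b)`, their order /
  pair facts (rank matching `o_i ~ t_i`, `h ~ a, b`, `a ~ b`);
* the five certificate words `S₁ = o₍₁₎+t₍₃₎`, `S₂ = o₍₂₎+t₍₂₎`, `S₃ = o₍₃₎+t₍₁₎`, `V = u + max(h, a₊)`, `W = F + E` are increasing with the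
  pair condition and take values in `[-2,2]`.
Part 3 assembles these with the row decomposition, `rearr3` and the Profile Lemma into `corP_andProd_q311_nonneg`.
HONEST LABEL: elementary bookkeeping lemmas (indicator arithmetic, `omega` case analyses); standard axioms. [this work]
-/

namespace Summit.CriticalPhenomena.PercolationContinuityZ3.Theorems

namespace FiveUpSet

open Finset Q311Cert

variable {γ₁ γ₂ : Type} [DecidableEq γ₁] [Fintype γ₁] [DecidableEq γ₂] [Fintype γ₂]

/-! ### The block -/

/-- The embedding of the three `z`-indices `Fin 3` into `Fin 5` (`i ↦ i + 2`). [this work] -/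
def zId (i : Fin 3) : Fin 5 := ⟨i.val + 2, by omega⟩

/-- `q311 = maj₃(x₀, x₁, z₂z₃z₄)` as a family of subsets of `Fin 5`: `⊤`, `⊤ − i` (`i = 4,3,2`), `a = ⊤ − 1`, `b = ⊤ − 0`, `{0,1,i}`,
`h = {0,1}`. [this work] -/
def q311 : Finset (Finset (Fin 5)) :=
  {univ, univ.erase 4, univ.erase 3, univ.erase 2, univ.erase 1, univ.erase 0, {0, 1, 2}, {0, 1, 3}, {0, 1, 4}, {0, 1}}

/-- `q311` is an up-set. [this work] -/
theorem isUpperSet_q311 : IsUpperSet (q311 : Set (Finset (Fin 5))) := by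
  intro y y' h hy
  have key : ∀ s ∈ q311, ∀ t : Finset (Fin 5), s ⊆ t → t ∈ q311 := by decide
  exact key y hy y' h

/-- `q311` is antipode-free. [this work] -/
theorem disjoint_q311_refl : Disjoint q311 (refl q311) := by decide

/-- Summing over `q311`: top, `h`, `a`, `b`, the three co-atoms `⊤ − (i+2)` and the three triples `{0,1,i+2}`. [this work] -/
theorem sum_q311 (f : Finset (Fin 5) → ℤ) :
    ∑ y ∈ q311, f y = f univ + f {0, 1} + f (univ.erase 1) + f (univ.erase 0)
      + ∑ i : Fin 3, f (univ.erase (zId i)) + ∑ i : Fin 3, f {0, 1, zId i} := by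
  rw [q311, Fin.sum_univ_three, Fin.sum_univ_three, sum_insert (by decide), sum_insert (by decide), sum_insert (by decide),
    sum_insert (by decide), sum_insert (by decide), sum_insert (by decide), sum_insert (by decide), sum_insert (by decide),
    sum_insert (by decide), sum_singleton]
  show f univ + (f (univ.erase 4) + (f (univ.erase 3) + (f (univ.erase 2) + (f (univ.erase 1) + (f (univ.erase 0)
      + (f {0, 1, 2} + (f {0, 1, 3} + (f {0, 1, 4} + f {0, 1})))))))) =
    f univ + f {0, 1} + f (univ.erase 1) + f (univ.erase 0)
      + (f (univ.erase (2 : Fin 5)) + f (univ.erase (3 : Fin 5)) + f (univ.erase (4 : Fin 5)))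
      + (f {0, 1, (2 : Fin 5)} + f {0, 1, (3 : Fin 5)} + f {0, 1, (4 : Fin 5)})
  ring

/-! ### Generic fibre columns of a family on `2^{γ₁ ⊕ γ₂}` -/

/-- Fibre column over `y`: `δ_A(x ⊔ y) = [x ⊔ y ∈ A] − [xᶜ ⊔ yᶜ ∈ A]`. [this work] -/
def bcol (A : Finset (Finset (γ₁ ⊕ γ₂))) (y : Finset γ₂) (x : Finset γ₁) : ℤ := sgnDiff A (refl A) (x.disjSum y)

/-- The fibre column as a difference of indicators. [this work] -/
theorem bcol_eq (A : Finset (Finset (γ₁ ⊕ γ₂))) (y : Finset γ₂) (x : Finset γ₁) :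
    bcol A y x = ind A (x.disjSum y) - ind A (xᶜ.disjSum yᶜ) := by
  unfold bcol; rw [sgnDiff_refl_eq, compl_disjSum]

/-- Fibre column values lie in `[-1,1]`. [this work] -/
theorem bcol_bounds (A : Finset (Finset (γ₁ ⊕ γ₂))) (y : Finset γ₂) (x : Finset γ₁) : -1 ≤ bcol A y x ∧ bcol A y x ≤ 1 := by
  rw [bcol_eq]
  have h1 := ind_nonneg_le_one A (x.disjSum y)
  have h2 := ind_nonneg_le_one A (xᶜ.disjSum yᶜ)
  constructor <;> linarith

section bcolfacts
variable {A : Finset (Finset (γ₁ ⊕ γ₂))} (hA : IsUpperSet (A : Set (Finset (γ₁ ⊕ γ₂))))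
include hA

/-- Fibre columns are increasing in the point. [this work] -/
theorem bcol_mono (y : Finset γ₂) {x x' : Finset γ₁} (h : x ⊆ x') : bcol A y x ≤ bcol A y x' := by
  rw [bcol_eq, bcol_eq]
  have h1 := ind_mono_pt hA (disjSum_mono h (le_refl y))
  have h2 := ind_mono_pt hA (disjSum_mono (compl_subset_compl.2 h) (le_refl yᶜ))
  linarith

/-- Fibre columns are increasing in the fibre index. [this work] -/
theorem bcol_mono_fibre {y y' : Finset γ₂} (h : y ⊆ y') (x : Finset γ₁) : bcol A y x ≤ bcol A y' x := by
  rw [bcol_eq, bcol_eq]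
  have h1 := ind_mono_pt hA (disjSum_mono (le_refl x) h)
  have h2 := ind_mono_pt hA (disjSum_mono (le_refl xᶜ) (compl_subset_compl.2 h))
  linarith

/-- **Pair condition**: if `x ∪ x' = ⊤` and `y ∪ y' = ⊤` then `δ_A(x⊔y) + δ_A(x'⊔y') ≥ 0`. [this work] -/
theorem bcol_pair {y y' : Finset γ₂} (hy : y ∪ y' = univ) {x x' : Finset γ₁} (h : x ∪ x' = univ) :
    0 ≤ bcol A y x + bcol A y' x' := by
  rw [bcol_eq, bcol_eq]
  have hc : xᶜ ⊆ x' := by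
    intro a ha; rw [mem_compl] at ha
    have := mem_univ a; rw [← h, mem_union] at this; tauto
  have hc' : x'ᶜ ⊆ x := by
    intro a ha; rw [mem_compl] at ha
    have := mem_univ a; rw [← h, mem_union] at this; tauto
  have hyc : yᶜ ⊆ y' := by
    intro a ha; rw [mem_compl] at ha
    have := mem_univ a; rw [← hy, mem_union] at this; tauto
  have hyc' : y'ᶜ ⊆ y := by
    intro a ha; rw [mem_compl] at ha
    have := mem_univ a; rw [← hy, mem_union] at this; tauto
  have h1 := ind_mono_pt hA (disjSum_mono hc hyc)
  have h2 := ind_mono_pt hA (disjSum_mono hc' hyc')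
  linarith

end bcolfacts

/-! ### The named columns of `q311` and the sorted profiles -/

/-- Top column `u = δ_A(x ⊔ ⊤)`. [this work] -/
def qU (A : Finset (Finset (γ₁ ⊕ Fin 5))) (x : Finset γ₁) : ℤ := bcol A univ x

/-- Hinge column `h = δ_A(x ⊔ {0,1})`. [this work] -/
def qH (A : Finset (Finset (γ₁ ⊕ Fin 5))) (x : Finset γ₁) : ℤ := bcol A {0, 1} x

/-- Triple column `o_i = δ_A(x ⊔ {0,1,i+2})`. [this work] -/
def qO (A : Finset (Finset (γ₁ ⊕ Fin 5))) (i : Fin 3) (x : Finset γ₁) : ℤ := bcol A {0, 1, zId i} x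

/-- Co-atom column `t_i = δ_A(x ⊔ (⊤ − (i+2)))`. [this work] -/
def qT (A : Finset (Finset (γ₁ ⊕ Fin 5))) (i : Fin 3) (x : Finset γ₁) : ℤ := bcol A (univ.erase (zId i)) x

/-- Column `a = δ_A(x ⊔ (⊤ − 1))` (`x₀z₂z₃z₄`). [this work] -/
def qA (A : Finset (Finset (γ₁ ⊕ Fin 5))) (x : Finset γ₁) : ℤ := bcol A (univ.erase 1) x

/-- Column `b = δ_A(x ⊔ (⊤ − 0))` (`x₁z₂z₃z₄`). [this work] -/
def qB (A : Finset (Finset (γ₁ ⊕ Fin 5))) (x : Finset γ₁) : ℤ := bcol A (univ.erase 0) x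

/-- Sorted `o`-profile: minimum. [this work] -/
def oMin (A : Finset (Finset (γ₁ ⊕ Fin 5))) (x : Finset γ₁) : ℤ := min (min (qO A 0 x) (qO A 1 x)) (qO A 2 x)

/-- Sorted `o`-profile: maximum. [this work] -/
def oMax (A : Finset (Finset (γ₁ ⊕ Fin 5))) (x : Finset γ₁) : ℤ := max (max (qO A 0 x) (qO A 1 x)) (qO A 2 x)

/-- Sorted `o`-profile: median. [this work] -/
def oMed (A : Finset (Finset (γ₁ ⊕ Fin 5))) (x : Finset γ₁) : ℤ := qO A 0 x + qO A 1 x + qO A 2 x - oMin A x - oMax A x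

/-- Sorted `t`-profile: minimum. [this work] -/
def qtMin (A : Finset (Finset (γ₁ ⊕ Fin 5))) (x : Finset γ₁) : ℤ := min (min (qT A 0 x) (qT A 1 x)) (qT A 2 x)

/-- Sorted `t`-profile: maximum. [this work] -/
def qtMax (A : Finset (Finset (γ₁ ⊕ Fin 5))) (x : Finset γ₁) : ℤ := max (max (qT A 0 x) (qT A 1 x)) (qT A 2 x)

/-- Sorted `t`-profile: median. [this work] -/
def qtMed (A : Finset (Finset (γ₁ ⊕ Fin 5))) (x : Finset γ₁) : ℤ := qT A 0 x + qT A 1 x + qT A 2 x - qtMin A x - qtMax A x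

/-- Sorted pair `(a,b)`: minimum `a₋`. [this work] -/
def aLo (A : Finset (Finset (γ₁ ⊕ Fin 5))) (x : Finset γ₁) : ℤ := min (qA A x) (qB A x)

/-- Sorted pair `(a,b)`: maximum `a₊`. [this work] -/
def aHi (A : Finset (Finset (γ₁ ⊕ Fin 5))) (x : Finset γ₁) : ℤ := max (qA A x) (qB A x)

/-- Word `S₁ = o₍₁₎ + t₍₃₎`. [this work] -/
def qS1 (A : Finset (Finset (γ₁ ⊕ Fin 5))) (x : Finset γ₁) : ℤ := oMin A x + qtMax A x

/-- Word `S₂ = o₍₂₎ + t₍₂₎`. [this work] -/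
def qS2 (A : Finset (Finset (γ₁ ⊕ Fin 5))) (x : Finset γ₁) : ℤ := oMed A x + qtMed A x

/-- Word `S₃ = o₍₃₎ + t₍₁₎`. [this work] -/
def qS3 (A : Finset (Finset (γ₁ ⊕ Fin 5))) (x : Finset γ₁) : ℤ := oMax A x + qtMin A x

/-- Word `V = u + max(h, a₊)`. [this work] -/
def qV (A : Finset (Finset (γ₁ ⊕ Fin 5))) (x : Finset γ₁) : ℤ := qU A x + max (qH A x) (aHi A x)

/-- Word `W = F + E` (the two indicator words of part 1 composed with the profile). [this work] -/
def qW (A : Finset (Finset (γ₁ ⊕ Fin 5))) (x : Finset γ₁) : ℤ :=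
  wF (qH A x) (aLo A x) (aHi A x) + wE (qH A x) (aLo A x) (aHi A x)

/-! ### Abstract facts about the words `F`, `E` as functions of integers -/

/-- `F + E` is monotone in its arguments (on `[-1,1]`). [this work] -/
theorem qFE_mono {h m M h' m' M' : ℤ} (hh : h ≤ h') (hm : m ≤ m') (hM : M ≤ M') (bh : -1 ≤ h) (bh' : h' ≤ 1) (bm : -1 ≤ m)
    (bm' : m' ≤ 1) (bM : -1 ≤ M) (bM' : M' ≤ 1) :
    wF h m M + wE h m M ≤ wF h' m' M' + wE h' m' M' := by
  unfold wF wE; split_ifs <;> omega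

/-- Values of `F + E` lie in `[-2,2]`. [this work] -/
theorem qFE_bounds (h m M : ℤ) : -2 ≤ wF h m M + wE h m M ∧ wF h m M + wE h m M ≤ 2 := by
  unfold wF wE; split_ifs <;> omega

/-- Pair condition for `F + E` from the pair facts `h ~ a₋`, `a₋ ~ a₊` at two points covering `⊤`. [this work] -/
theorem qFE_pair {h m M h' m' M' : ℤ} (bh : -1 ≤ h) (bh1 : h ≤ 1) (bmM : m ≤ M) (bM1 : M ≤ 1) (bm : -1 ≤ m)
    (bh' : -1 ≤ h') (bh1' : h' ≤ 1) (bmM' : m' ≤ M') (bM1' : M' ≤ 1) (bm' : -1 ≤ m')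
    (p1 : 0 ≤ h + m') (p2 : 0 ≤ m + h') (p3 : 0 ≤ m + M') (p4 : 0 ≤ M + m') :
    0 ≤ wF h m M + wE h m M + (wF h' m' M' + wE h' m' M') := by
  unfold wF wE; split_ifs <;> omega

section facts
variable {A : Finset (Finset (γ₁ ⊕ Fin 5))} (hA : IsUpperSet (A : Set (Finset (γ₁ ⊕ Fin 5))))

/-- Bounds of the named columns. [this work] -/
theorem qcols_bounds (x : Finset γ₁) :
    (-1 ≤ qU A x ∧ qU A x ≤ 1) ∧ (-1 ≤ qH A x ∧ qH A x ≤ 1) ∧ (-1 ≤ qA A x ∧ qA A x ≤ 1) ∧ (-1 ≤ qB A x ∧ qB A x ≤ 1)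
      ∧ (∀ i : Fin 3, (-1 ≤ qO A i x ∧ qO A i x ≤ 1) ∧ (-1 ≤ qT A i x ∧ qT A i x ≤ 1)) :=
  ⟨bcol_bounds A _ x, bcol_bounds A _ x, bcol_bounds A _ x, bcol_bounds A _ x, fun _ => ⟨bcol_bounds A _ x, bcol_bounds A _ x⟩⟩

/-- Bounds of the eight profile statistics. [this work] -/
theorem qstats_bounds (x : Finset γ₁) :
    (-1 ≤ oMin A x ∧ oMin A x ≤ 1) ∧ (-1 ≤ oMed A x ∧ oMed A x ≤ 1) ∧ (-1 ≤ oMax A x ∧ oMax A x ≤ 1)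
      ∧ (-1 ≤ qtMin A x ∧ qtMin A x ≤ 1) ∧ (-1 ≤ qtMed A x ∧ qtMed A x ≤ 1) ∧ (-1 ≤ qtMax A x ∧ qtMax A x ≤ 1)
      ∧ (-1 ≤ aLo A x ∧ aLo A x ≤ 1) ∧ (-1 ≤ aHi A x ∧ aHi A x ≤ 1) := by
  obtain ⟨_, _, ha, hb, hi⟩ := qcols_bounds (A := A) x
  have h0 := hi 0; have h1 := hi 1; have h2 := hi 2
  unfold oMed oMin oMax qtMed qtMin qtMax aLo aHi
  refine ⟨⟨?_, ?_⟩, ⟨?_, ?_⟩, ⟨?_, ?_⟩, ⟨?_, ?_⟩, ⟨?_, ?_⟩, ⟨?_, ?_⟩, ⟨?_, ?_⟩, ⟨?_, ?_⟩⟩ <;> omega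

/-- Sortedness: `o₍₁₎ ≤ o₍₂₎ ≤ o₍₃₎`, `t₍₁₎ ≤ t₍₂₎ ≤ t₍₃₎`, `a₋ ≤ a₊`. [this work] -/
theorem qstats_sorted (x : Finset γ₁) :
    oMin A x ≤ oMed A x ∧ oMed A x ≤ oMax A x ∧ qtMin A x ≤ qtMed A x ∧ qtMed A x ≤ qtMax A x ∧ aLo A x ≤ aHi A x := by
  unfold oMed oMin oMax qtMed qtMin qtMax aLo aHi
  refine ⟨?_, ?_, ?_, ?_, ?_⟩ <;> omega

include hA

/-- Order facts: `h ≤ o₍₁₎`, `o₍₂₎ ≤ t₍₁₎`, `o₍₃₎ ≤ t₍₂₎`, `t₍₃₎ ≤ u`, `a₊ ≤ u`. [this work] -/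
theorem qstats_order (x : Finset γ₁) :
    qH A x ≤ oMin A x ∧ oMed A x ≤ qtMin A x ∧ oMax A x ≤ qtMed A x ∧ qtMax A x ≤ qU A x ∧ aHi A x ≤ qU A x := by
  have hho : ∀ i : Fin 3, qH A x ≤ qO A i x := fun i => bcol_mono_fibre hA (by fin_cases i <;> decide) x
  have ht : ∀ i : Fin 3, qT A i x ≤ qU A x := fun i => bcol_mono_fibre hA (subset_univ _) x
  have hot : ∀ i j : Fin 3, i ≠ j → qO A i x ≤ qT A j x := by
    intro i j hij
    have hs : ({0, 1, zId i} : Finset (Fin 5)) ⊆ univ.erase (zId j) := by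
      fin_cases i <;> fin_cases j <;> first | exact absurd rfl hij | decide
    exact bcol_mono_fibre hA hs x
  have hau : qA A x ≤ qU A x := bcol_mono_fibre hA (subset_univ _) x
  have hbu : qB A x ≤ qU A x := bcol_mono_fibre hA (subset_univ _) x
  have g0 := hho 0; have g1 := hho 1; have g2 := hho 2; have t0 := ht 0; have t1 := ht 1; have t2 := ht 2
  have o01 := hot 0 1 (by decide); have o02 := hot 0 2 (by decide); have o10 := hot 1 0 (by decide)
  have o12 := hot 1 2 (by decide); have o20 := hot 2 0 (by decide); have o21 := hot 2 1 (by decide)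
  refine ⟨?_, ?_, ?_, ?_, ?_⟩
  · unfold oMin; omega
  · unfold oMed oMin oMax qtMin; omega
  · unfold oMax qtMed qtMin qtMax; omega
  · unfold qtMax; omega
  · unfold aHi; omega

/-- Monotonicity of the columns and statistics in the point. [this work] -/
theorem qstats_mono {x x' : Finset γ₁} (h : x ⊆ x') :
    qU A x ≤ qU A x' ∧ qH A x ≤ qH A x' ∧ oMin A x ≤ oMin A x' ∧ oMed A x ≤ oMed A x' ∧ oMax A x ≤ oMax A x'
      ∧ qtMin A x ≤ qtMin A x' ∧ qtMed A x ≤ qtMed A x' ∧ qtMax A x ≤ qtMax A x' ∧ aLo A x ≤ aLo A x' ∧ aHi A x ≤ aHi A x' := by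
  have ho : ∀ i : Fin 3, qO A i x ≤ qO A i x' := fun i => bcol_mono hA _ h
  have ht : ∀ i : Fin 3, qT A i x ≤ qT A i x' := fun i => bcol_mono hA _ h
  have ha : qA A x ≤ qA A x' := bcol_mono hA _ h
  have hb : qB A x ≤ qB A x' := bcol_mono hA _ h
  have p0 := ho 0; have p1 := ho 1; have p2 := ho 2; have t0 := ht 0; have t1 := ht 1; have t2 := ht 2
  refine ⟨bcol_mono hA _ h, bcol_mono hA _ h, ?_, ?_, ?_, ?_, ?_, ?_, ?_, ?_⟩
  · unfold oMin; omega
  · unfold oMed oMin oMax; simp only [min_def, max_def]; split_ifs <;> omega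
  · unfold oMax; omega
  · unfold qtMin; omega
  · unfold qtMed qtMin qtMax; simp only [min_def, max_def]; split_ifs <;> omega
  · unfold qtMax; omega
  · unfold aLo; omega
  · unfold aHi; omega

/-- **Pair facts between the statistics** at two points covering `⊤` (rank matching `o_i ~ t_i`; `h ~ a, b`; `a ~ b`; `u ~ ⊤`). [this work] -/
theorem qstats_pair {x x' : Finset γ₁} (h : x ∪ x' = univ) :
    0 ≤ oMin A x + qtMax A x' ∧ 0 ≤ oMed A x + qtMed A x' ∧ 0 ≤ oMax A x + qtMin A x'
      ∧ 0 ≤ qH A x + aLo A x' ∧ 0 ≤ aLo A x + aHi A x' ∧ 0 ≤ qU A x + qU A x' := by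
  have hOT : ∀ i : Fin 3, 0 ≤ qO A i x + qT A i x' := by
    intro i
    have hy : ({0, 1, zId i} : Finset (Fin 5)) ∪ univ.erase (zId i) = univ := by fin_cases i <;> decide
    exact bcol_pair hA hy h
  have hHA : 0 ≤ qH A x + qA A x' := bcol_pair hA (by decide) h
  have hHB : 0 ≤ qH A x + qB A x' := bcol_pair hA (by decide) h
  have hAB : 0 ≤ qA A x + qB A x' := bcol_pair hA (by decide) h
  have hBA : 0 ≤ qB A x + qA A x' := bcol_pair hA (by decide) h
  have hUU : 0 ≤ qU A x + qU A x' := bcol_pair hA (by simp) h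
  have a0 := hOT 0; have a1 := hOT 1; have a2 := hOT 2
  refine ⟨?_, ?_, ?_, ?_, ?_, hUU⟩
  · unfold oMin qtMax; omega
  · unfold oMed oMin oMax qtMed qtMin qtMax; simp only [min_def, max_def]; split_ifs <;> omega
  · unfold oMax qtMin; omega
  · unfold aLo; omega
  · unfold aLo aHi; omega

/-- The five words are increasing in the point. [this work] -/
theorem qwords_mono {x x' : Finset γ₁} (h : x ⊆ x') :
    qS1 A x ≤ qS1 A x' ∧ qS2 A x ≤ qS2 A x' ∧ qS3 A x ≤ qS3 A x' ∧ qV A x ≤ qV A x' ∧ qW A x ≤ qW A x' := by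
  obtain ⟨hu, hh, h1, h2, h3, h4, h5, h6, h7, h8⟩ := qstats_mono hA h
  obtain ⟨_, bh, _⟩ := qcols_bounds (A := A) x
  obtain ⟨_, bh', _⟩ := qcols_bounds (A := A) x'
  obtain ⟨_, _, _, _, _, _, bl, bH⟩ := qstats_bounds (A := A) x
  obtain ⟨_, _, _, _, _, _, bl', bH'⟩ := qstats_bounds (A := A) x'
  refine ⟨by unfold qS1; omega, by unfold qS2; omega, by unfold qS3; omega, by unfold qV; omega, ?_⟩
  exact qFE_mono hh h7 h8 bh.1 bh'.2 bl.1 bl'.2 bH.1 bH'.2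

omit hA in
/-- Bounds of the five words (all in `[-2,2]`). [this work] -/
theorem qwords_bounds (x : Finset γ₁) :
    (-2 ≤ qS1 A x ∧ qS1 A x ≤ 2) ∧ (-2 ≤ qS2 A x ∧ qS2 A x ≤ 2) ∧ (-2 ≤ qS3 A x ∧ qS3 A x ≤ 2) ∧ (-2 ≤ qV A x ∧ qV A x ≤ 2)
      ∧ (-2 ≤ qW A x ∧ qW A x ≤ 2) := by
  obtain ⟨bu, bh, _⟩ := qcols_bounds (A := A) x
  obtain ⟨bom, bod, boM, btm, btd, btM, bl, bH⟩ := qstats_bounds (A := A) x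
  refine ⟨by unfold qS1; omega, by unfold qS2; omega, by unfold qS3; omega, by unfold qV; omega, qFE_bounds _ _ _⟩

/-- **Pair conditions of the five words**: `x ∪ x' = ⊤ ⟹ w(x) + w(x') ≥ 0`. [this work] -/
theorem qwords_pair {x x' : Finset γ₁} (h : x ∪ x' = univ) :
    0 ≤ qS1 A x + qS1 A x' ∧ 0 ≤ qS2 A x + qS2 A x' ∧ 0 ≤ qS3 A x + qS3 A x' ∧ 0 ≤ qV A x + qV A x' ∧ 0 ≤ qW A x + qW A x' := by
  have h' : x' ∪ x = univ := by rw [union_comm]; exact h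
  obtain ⟨a1, a2, a3, a4, a5, huu⟩ := qstats_pair hA h
  obtain ⟨b1, b2, b3, b4, b5, _⟩ := qstats_pair hA h'
  obtain ⟨_, bh, _⟩ := qcols_bounds (A := A) x
  obtain ⟨_, bh', _⟩ := qcols_bounds (A := A) x'
  obtain ⟨_, _, _, _, _, _, bl, bH⟩ := qstats_bounds (A := A) x
  obtain ⟨_, _, _, _, _, _, bl', bH'⟩ := qstats_bounds (A := A) x'
  obtain ⟨_, _, _, _, st⟩ := qstats_sorted (A := A) x
  obtain ⟨_, _, _, _, st'⟩ := qstats_sorted (A := A) x'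
  refine ⟨by unfold qS1; omega, by unfold qS2; omega, by unfold qS3; omega, ?_, ?_⟩
  · unfold qV; simp only [max_def]; split_ifs <;> omega
  · unfold qW
    exact qFE_pair bh.1 bh.2 st bH.2 bl.1 bh'.1 bh'.2 st' bH'.2 bl'.1 a4 (by linarith [b4]) a5 (by linarith [b5])

end facts

end FiveUpSet

end Summit.CriticalPhenomena.PercolationContinuityZ3.Theorems
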